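import Literature.NumberTheory.EllipticCurves.PeriodIndexObstruction
import HarnessLib

/-!
# The period–index obstruction, II: continuity, and vanishing for split torsors

`Proofs`-style file (theorems only; no definitions, no named facts) under the provefact seat on
`Literature.NumberTheory.EllipticCurves.Cassels1962_index_eq_period_of_mem_sha`, continuing
`PeriodIndexObstruction`, which reduced Cassels' `I = P` on `Ш` to: *the obstruction
`2`-cocycle `e(σ,τ) = f_σ ρ_σ(f_τ)/f_{στ} ∈ K̄^×` of every Selmer class is a continuous
coboundary* (`Cassels1962_index_eq_period_of_mem_sha_of_obstruction`). In print this follows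
from (i) `e` is locally trivial at every place — "`V(K) ≠ ∅` implies `δ ≡ 0`", applied over the
completions, where the torsor of a locally trivial class has a point — and (ii) the reciprocity
law / Hasse principle for `Br(K)` (Clark 2006, Prop. 6, second proof). This file proves the two
ingredients of (i) that live over a single base field:

* **continuity**: `K̄(E)` is a smooth `Γ_K`-set — every rational function is fixed by an open
  subgroup (`exists_isOpen_forall_galFunctionField_eq`: the coefficients of a representation
  `p(x,y)/q(x,y)` generate a finite extension, whose group is open,
  `IntermediateField.fixingSubgroup_isOpen`), so `σ ↦ σ̃ w` and `(σ, y) ↦ ρ_σ(f y)` are locally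
  constant (`isLocallyConstant_galFunctionField`, `isLocallyConstant_twistGal_comp`) and **the
  obstruction cocycle `e` is locally constant on `Γ_K × Γ_K`** (`isLocallyConstant_obstruction`),
  i.e. a continuous `2`-cochain with values in the discrete module `K̄^×`;
* **split torsors have trivial obstruction** (`exists_obstruction_eq_coboundary_of_principal`):
  if `c(σ) = σQ - Q` is principal then for every rational divisor class `n·(T)`
  (`n(σ⋆T - T) = O`) and every admissible locally constant `f`, `e = ∂b` with `b : Γ_K → K̄^×`
  locally constant — with `T₀ = T + Q`, `S₀ = nT₀` is invariant, a function `h` with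
  `div h = n(T₀) - (n-1)(O) - (S₀)` (Silverman Cor. III.3.5, `exists_ord_eq`) gives split
  functions `f⁰_σ = τ_Q^*(σ̃h/h)` with `f⁰_σ ρ_σ(f⁰_τ) = f⁰_{στ}` exactly, and `f_σ = b(σ) f⁰_σ`.

Applied over a completion `K_v` (to the base-changed curve, the restricted-and-pushed cocycle,
which is principal when the class lies in `WeierstrassCurve.localRestrictionKer`), the second
statement is the local triviality of `e`; the comparison of the obstruction along
`K̄(E) → K̄_v(E)` is the subject of the sequel.

## References

* P. L. Clark, *There are genus one curves of every index over every number field*, J. reine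
  angew. Math. 594 (2006) 201–206, Prop. 6 (second proof); arXiv:math/0411413 read. [Clark2006Crelle]
* P. L. Clark, S. Sharif, *Period, index and potential Ш*, Algebra & Number Theory 4 (2010)
  151–174, §2 eq. (3); arXiv:0811.3019. [ClarkSharif2010]
* J. H. Silverman, *The Arithmetic of Elliptic Curves*, 2nd ed., GTM 106: II.§2 (action of
  `G_{K̄/K}` on `K̄(C)`), Cor. III.3.5, X.§2–3. [SilvermanAEC2009]
* J.-P. Serre, *Galois Cohomology*, II.§1 (discrete `Γ_K`-modules).

## Design

As in `PeriodIndexObstruction`: no definitions; the twisted action is written out as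
`W.transAlgHom (-(c.1 σ)) (W.galFunctionField σ z)`, continuity as `IsLocallyConstant`.
-/

noncomputable section

open scoped Classical
open scoped Polynomial.Bivariate

universe u

namespace Literature.NumberTheory.EllipticCurves

open GaloisRepresentations WeierstrassCurve WeierstrassFunctionField Polynomial

/-! ### `K̄(E)` is a smooth `Γ_K`-set: stabilisers of functions are open -/

section Smooth

variable {K : Type u} [Field K] (W : WeierstrassCurve K)

/-- A bivariate polynomial all of whose coefficients are fixed by a ring endomorphism is fixed by
the coefficientwise action. [folklore] -/
theorem map_mapRingHom_eq_self_of_forall {k : Type*} [CommRing k] (g : k →+* k) (p : k[X][Y])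
    (h : ∀ q ∈ p.coeffs, ∀ a ∈ q.coeffs, g a = a) : p.map (mapRingHom g) = p := by
  refine Polynomial.ext fun i ↦ ?_
  rw [coeff_map, coe_mapRingHom]
  by_cases hi : p.coeff i = 0
  · rw [hi, Polynomial.map_zero]
  refine Polynomial.ext fun j ↦ ?_
  rw [coeff_map]
  by_cases hj : (p.coeff i).coeff j = 0
  · rw [hj, map_zero]
  exact h _ (coeff_mem_coeffs hi) _ (coeff_mem_coeffs hj)

/-- **Every rational function on `E_{K̄}` is fixed by an open subgroup of `Γ_K`**: writing
`w = p(x,y)/q(x,y)` with `p, q ∈ K̄[X][Y]`, the group `Gal(K̄/K(S))` of the finite extension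
generated by the (finitely many) coefficients `S` of `p` and `q` fixes `w` (`σ̃` acts on the
coefficients), and it is open for the Krull topology (`IntermediateField.fixingSubgroup_isOpen`).
So `K̄(E)` is a discrete `Γ_K`-module in the sense of Serre, *Galois Cohomology*, II.§1 (every
element has open stabiliser); Silverman, *AEC*, II.§2 (`K̄(C) = K̄ · K(C)`). [folklore] -/
theorem exists_isOpen_forall_galFunctionField_eq (w : W.geomFunctionField) :
    ∃ U : Subgroup (Field.absoluteGaloisGroup K), IsOpen (U : Set (Field.absoluteGaloisGroup K)) ∧
      ∀ σ ∈ U, W.galFunctionField σ w = w := by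
  obtain ⟨r₁, r₂, -, rfl⟩ := IsFractionRing.div_surjective (A := W.geomCoordRing) w
  obtain ⟨p₁, rfl⟩ := AdjoinRoot.mk_surjective r₁
  obtain ⟨p₂, rfl⟩ := AdjoinRoot.mk_surjective r₂
  -- the finite set of coefficients and the finite extension it generates
  let S : Finset (AlgebraicClosure K) :=
    p₁.coeffs.biUnion Polynomial.coeffs ∪ p₂.coeffs.biUnion Polynomial.coeffs
  let F : IntermediateField K (AlgebraicClosure K) := IntermediateField.adjoin K (S : Set (AlgebraicClosure K))
  haveI : FiniteDimensional K F :=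
    IntermediateField.finiteDimensional_adjoin fun x _ ↦ Algebra.IsIntegral.isIntegral x
  refine ⟨F.fixingSubgroup, F.fixingSubgroup_isOpen, fun σ hσ ↦ ?_⟩
  have hσ' : ∀ x ∈ F, (show AlgebraicClosure K ≃ₐ[K] AlgebraicClosure K from σ) x = x :=
    (IntermediateField.mem_fixingSubgroup_iff F σ).mp hσ
  have hfix : ∀ a ∈ S, galRingHom σ a = a := fun a ha ↦
    hσ' a (IntermediateField.subset_adjoin K _ (Finset.mem_coe.mpr ha))
  have h₁ : p₁.map (mapRingHom (galRingHom σ)) = p₁ :=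
    map_mapRingHom_eq_self_of_forall _ p₁ fun q hq a ha ↦ hfix a
      (Finset.mem_union_left _ (Finset.mem_biUnion.mpr ⟨q, hq, ha⟩))
  have h₂ : p₂.map (mapRingHom (galRingHom σ)) = p₂ :=
    map_mapRingHom_eq_self_of_forall _ p₂ fun q hq a ha ↦ hfix a
      (Finset.mem_union_right _ (Finset.mem_biUnion.mpr ⟨q, hq, ha⟩))
  rw [map_div₀, galFunctionField_algebraMap, galFunctionField_algebraMap, galCoordRing_mk,
    galCoordRing_mk, h₁, h₂]

/-- **The stabiliser of a rational function is open** (it is a subgroup, by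
`galFunctionField_mul`, containing the open subgroup of
`exists_isOpen_forall_galFunctionField_eq`). Serre, *Galois Cohomology*, II.§1. [folklore] -/
theorem isOpen_setOf_galFunctionField_eq (w : W.geomFunctionField) :
    IsOpen {σ : Field.absoluteGaloisGroup K | W.galFunctionField σ w = w} := by
  let St : Subgroup (Field.absoluteGaloisGroup K) :=
    { carrier := {σ | W.galFunctionField σ w = w}
      mul_mem' := fun {σ τ} hσ hτ ↦ by
        change W.galFunctionField (σ * τ) w = w
        rw [galFunctionField_mul, hτ, hσ]
      one_mem' := galFunctionField_one W w
      inv_mem' := fun {σ} hσ ↦ by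
        change W.galFunctionField σ⁻¹ w = w
        apply (W.galFunctionField σ).injective
        rw [← galFunctionField_mul, mul_inv_cancel, galFunctionField_one, hσ] }
  obtain ⟨U, hU, hUw⟩ := exists_isOpen_forall_galFunctionField_eq W w
  exact Subgroup.isOpen_mono (H₁ := U) (H₂ := St) (fun σ hσ ↦ hUw σ hσ) hU

/-- **`σ ↦ σ̃ w` is locally constant** on `Γ_K`, for every `w ∈ K̄(E)` (near `σ₀` it is constant
on the coset `σ₀ · Stab(w)`, open by `isOpen_setOf_galFunctionField_eq`). [folklore] -/
theorem isLocallyConstant_galFunctionField (w : W.geomFunctionField) :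
    IsLocallyConstant fun σ : Field.absoluteGaloisGroup K ↦ W.galFunctionField σ w := by
  refine (IsLocallyConstant.iff_exists_open _).mpr fun σ₀ ↦ ?_
  refine ⟨(fun σ ↦ σ₀⁻¹ * σ) ⁻¹' {σ | W.galFunctionField σ w = w},
    (isOpen_setOf_galFunctionField_eq W w).preimage (continuous_const.mul continuous_id), ?_, ?_⟩
  · change W.galFunctionField (σ₀⁻¹ * σ₀) w = w
    rw [inv_mul_cancel, galFunctionField_one]
  · intro σ hσ
    change W.galFunctionField (σ₀⁻¹ * σ) w = w at hσ
    have h : σ = σ₀ * (σ₀⁻¹ * σ) := by group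
    show W.galFunctionField σ w = W.galFunctionField σ₀ w
    rw [h, galFunctionField_mul, hσ]

/-- **`(σ, y) ↦ σ̃ (f y)` is locally constant** on `Γ_K × Y` for a locally constant `f`.
[folklore] -/
theorem isLocallyConstant_galFunctionField_comp {ι : Type*} [TopologicalSpace ι]
    {f : ι → W.geomFunctionField} (hf : IsLocallyConstant f) :
    IsLocallyConstant fun p : Field.absoluteGaloisGroup K × ι ↦ W.galFunctionField p.1 (f p.2) := by
  refine (IsLocallyConstant.iff_exists_open _).mpr fun p₀ ↦ ?_
  obtain ⟨U, hU, hU₀, hUc⟩ :=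
    (IsLocallyConstant.iff_exists_open _).mp (isLocallyConstant_galFunctionField W (f p₀.2)) p₀.1
  obtain ⟨V, hV, hV₀, hVc⟩ := (IsLocallyConstant.iff_exists_open _).mp hf p₀.2
  refine ⟨U ×ˢ V, hU.prod hV, ⟨hU₀, hV₀⟩, ?_⟩
  rintro ⟨σ, y⟩ ⟨hσ, hy⟩
  simp only at hσ hy ⊢
  rw [hVc y hy, hUc σ hσ]

variable [W.IsElliptic]
variable (c : contOneCocycles (discreteTopRep (Field.absoluteGaloisGroup K) (WeierstrassCurve.geomPoints W)))

/-- **`(σ, y) ↦ ρ_σ (f y)` is locally constant** for the twisted action `ρ_σ = τ_{-c(σ)}^* ∘ σ̃`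
of a continuous cocycle and a locally constant `f`. [folklore] -/
theorem isLocallyConstant_twistGal_comp {ι : Type*} [TopologicalSpace ι]
    {f : ι → W.geomFunctionField} (hf : IsLocallyConstant f) :
    IsLocallyConstant fun p : Field.absoluteGaloisGroup K × ι ↦
      W.transAlgHom (-(c.1 p.1)) (W.galFunctionField p.1 (f p.2)) := by
  have hc : IsLocallyConstant fun p : Field.absoluteGaloisGroup K × ι ↦ c.1 p.1 :=
    ((IsLocallyConstant.iff_continuous _).mpr c.1.continuous).comp_continuous continuous_fst
  exact hc.comp₂ (isLocallyConstant_galFunctionField_comp W hf) fun A u ↦ W.transAlgHom (-A) u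

/-- **The obstruction cocycle is continuous**: for locally constant `f : Γ_K → K̄(E)^×` and
`e : Γ_K → Γ_K → K̄` with `e(σ,τ) = f_σ ρ_σ(f_τ)/f_{στ}` (read in `K̄(E)`), the function
`(σ, τ) ↦ e(σ, τ)` is locally constant on `Γ_K × Γ_K`, i.e. `e` is a continuous `2`-cochain of
`Γ_K` with values in the discrete module `K̄^×`. [folklore] -/
theorem isLocallyConstant_obstruction (f : Field.absoluteGaloisGroup K → W.geomFunctionField)
    (hfc : IsLocallyConstant f) (e : Field.absoluteGaloisGroup K → Field.absoluteGaloisGroup K →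
      AlgebraicClosure K)
    (he : ∀ σ τ, algebraMap (AlgebraicClosure K) W.geomFunctionField (e σ τ) =
      f σ * W.transAlgHom (-(c.1 σ)) (W.galFunctionField σ (f τ)) / f (σ * τ)) :
    IsLocallyConstant fun p : Field.absoluteGaloisGroup K × Field.absoluteGaloisGroup K ↦
      e p.1 p.2 := by
  -- the right-hand side is locally constant on `Γ_K × Γ_K`
  have h1 : IsLocallyConstant fun p : Field.absoluteGaloisGroup K × Field.absoluteGaloisGroup K ↦
      f p.1 := hfc.comp_continuous continuous_fst
  have h2 : IsLocallyConstant fun p : Field.absoluteGaloisGroup K × Field.absoluteGaloisGroup K ↦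
      f (p.1 * p.2) := hfc.comp_continuous continuous_mul
  have h3 := isLocallyConstant_twistGal_comp W c (ι := Field.absoluteGaloisGroup K) hfc
  have hF : IsLocallyConstant fun p : Field.absoluteGaloisGroup K × Field.absoluteGaloisGroup K ↦
      f p.1 * W.transAlgHom (-(c.1 p.1)) (W.galFunctionField p.1 (f p.2)) / f (p.1 * p.2) :=
    (h1.comp₂ h3 fun a b ↦ a * b).comp₂ h2 fun a b ↦ a / b
  -- read `e` off through the injective `algebraMap`
  let g : W.geomFunctionField → AlgebraicClosure K := fun u ↦
    if h : ∃ x, algebraMap (AlgebraicClosure K) W.geomFunctionField x = u then h.choose else 0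
  have hg : ∀ x, g (algebraMap (AlgebraicClosure K) W.geomFunctionField x) = x := fun x ↦ by
    have hex : ∃ y, algebraMap (AlgebraicClosure K) W.geomFunctionField y =
        algebraMap (AlgebraicClosure K) W.geomFunctionField x := ⟨x, rfl⟩
    simp only [g, dif_pos hex]
    exact (algebraMap (AlgebraicClosure K) W.geomFunctionField).injective hex.choose_spec
  have heq : (fun p : Field.absoluteGaloisGroup K × Field.absoluteGaloisGroup K ↦ e p.1 p.2) =
      g ∘ fun p ↦ f p.1 * W.transAlgHom (-(c.1 p.1)) (W.galFunctionField p.1 (f p.2)) /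
        f (p.1 * p.2) := by
    funext p
    simp only [Function.comp_apply, ← he, hg]
  rw [heq]
  exact hF.comp g

end Smooth

/-! ### Split torsors: a principal cocycle has trivial obstruction -/

section Principal

variable {K : Type u} [Field K] (W : WeierstrassCurve K) [W.IsElliptic]
variable (c : contOneCocycles (discreteTopRep (Field.absoluteGaloisGroup K) (WeierstrassCurve.geomPoints W)))

/-- **For a principal cocycle the obstruction cocycle is a continuous coboundary.** Let
`c(σ) = σ Q - Q` (the torsor `C_c` has the `K`-rational point `-Q`), `T` with `n(σ⋆T - T) = O`
and `f_σ` any locally constant functions with `div f_σ = n(σ⋆T) - n(T)`. Then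
`f_σ ρ_σ(f_τ)/f_{στ} = b(σ) σ(b(τ))/b(στ)` for a locally constant `b : Γ_K → K̄^×`. Proof: with
`T₀ = T + Q` the point `S₀ = n T₀` is `Γ_K`-invariant, so there is `h` with
`div h = n(T₀) - (n-1)(O) - (S₀)` (Silverman Cor. III.3.5) and `div(σ̃h/h) = n(σT₀) - n(T₀)`;
the functions `f⁰_σ = τ_Q^*(σ̃h/h)` have the required divisors and satisfy
`f⁰_σ ρ_σ(f⁰_τ) = f⁰_{στ}` on the nose (`ρ_σ τ_Q^* = τ_Q^* σ̃` as `-c(σ) + σQ = Q`), and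
`f_σ = b(σ) f⁰_σ` with constants `b(σ)` (same divisor). This is the local input of Clark 2006,
Prop. 6, second proof — "`V(K) ≠ ∅` implies `δ ≡ 0`" — for the torsor `V = C_c`.
[cite: Clark2006Crelle, Prop. 6 (second proof)] [cite: SilvermanAEC2009, Cor. III.3.5] -/
theorem exists_obstruction_eq_coboundary_of_principal {n : ℤ} (Q : WeierstrassCurve.geomPoints W)
    (hcQ : ∀ σ, c.1 σ = σ • Q - Q) (T : WeierstrassCurve.geomPoints W)
    (hT : ∀ σ : Field.absoluteGaloisGroup K, n • (σ • T + c.1 σ - T) = 0)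
    (f : Field.absoluteGaloisGroup K → W.geomFunctionField) (hfc : IsLocallyConstant f)
    (hf0 : ∀ σ, f σ ≠ 0)
    (hford : ∀ σ P, ord (W.baseChange (AlgebraicClosure K)).toAffine P (f σ) =
      (Finsupp.single (σ • T + c.1 σ) n - Finsupp.single T n) P) :
    ∃ b : Field.absoluteGaloisGroup K → AlgebraicClosure K, IsLocallyConstant b ∧ (∀ σ, b σ ≠ 0) ∧
      ∀ σ τ, f σ * W.transAlgHom (-(c.1 σ)) (W.galFunctionField σ (f τ)) / f (σ * τ) =
        algebraMap (AlgebraicClosure K) W.geomFunctionField (b σ * σ • b τ / b (σ * τ)) := by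
  -- `T₀ = T + Q`, `S₀ = n T₀` is invariant
  set T₀ : WeierstrassCurve.geomPoints W := T + Q with hT₀
  have htwist : ∀ σ : Field.absoluteGaloisGroup K, σ • T + c.1 σ = σ • T₀ - Q := fun σ ↦ by
    rw [hcQ, hT₀, smul_add]
    abel
  have hS₀ : ∀ σ : Field.absoluteGaloisGroup K, σ • (n • T₀) = n • T₀ := fun σ ↦ by
    have h := hT σ
    rw [htwist, show σ • T₀ - Q - T = σ • T₀ - T₀ by rw [hT₀]; abel, smul_sub, sub_eq_zero] at h
    rw [smul_comm σ n T₀, h]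
  -- `h` with `div h = n(T₀) - (n-1)(O) - (S₀)`
  set Dh : WeierstrassCurve.geomPoints W →₀ ℤ :=
    Finsupp.single T₀ n - Finsupp.single 0 (n - 1) - Finsupp.single (n • T₀) 1 with hDh
  obtain ⟨h, hh0, hh⟩ : ∃ h : W.geomFunctionField, h ≠ 0 ∧
      ∀ P, ord (W.baseChange (AlgebraicClosure K)).toAffine P h = Dh P := by
    refine exists_ord_eq Dh ?_ ?_
    · rw [hDh, Finsupp.sum_sub_index (fun _ _ _ ↦ rfl), Finsupp.sum_sub_index (fun _ _ _ ↦ rfl),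
        Finsupp.sum_single_index rfl, Finsupp.sum_single_index rfl, Finsupp.sum_single_index rfl]
      ring
    · rw [hDh, Finsupp.sum_sub_index (fun _ _ _ ↦ sub_zsmul _ _ _),
        Finsupp.sum_sub_index (fun _ _ _ ↦ sub_zsmul _ _ _), Finsupp.sum_single_index (zero_zsmul _),
        Finsupp.sum_single_index (zero_zsmul _), Finsupp.sum_single_index (zero_zsmul _), smul_zero,
        sub_zero, one_smul, sub_self]
  -- `div (σ̃ h / h) = n(σ T₀) - n(T₀)`
  have hgh0 : ∀ σ : Field.absoluteGaloisGroup K, W.galFunctionField σ h ≠ 0 := fun σ ↦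
    (EmbeddingLike.map_ne_zero_iff).mpr hh0
  have hordg : ∀ (σ : Field.absoluteGaloisGroup K) (P : WeierstrassCurve.geomPoints W),
      ord (W.baseChange (AlgebraicClosure K)).toAffine P (W.galFunctionField σ h) = Dh (σ⁻¹ • P) := by
    intro σ P
    conv_lhs => rw [show P = σ • (σ⁻¹ • P) by rw [smul_inv_smul]]
    rw [ord_galFunctionField, hh]
  have hordq : ∀ (σ : Field.absoluteGaloisGroup K) (P : WeierstrassCurve.geomPoints W),
      ord (W.baseChange (AlgebraicClosure K)).toAffine P (W.galFunctionField σ h / h) =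
        (Finsupp.single (σ • T₀) n - Finsupp.single T₀ n) P := by
    intro σ P
    rw [ord_div P (hgh0 σ) hh0, hordg, hh]
    simp only [hDh, Finsupp.sub_apply, Finsupp.single_apply, eq_inv_smul_iff, smul_zero, hS₀]
    ring
  -- the split functions `f⁰_σ = τ_Q^* (σ̃ h / h)`
  set f₀ : Field.absoluteGaloisGroup K → W.geomFunctionField :=
    fun σ ↦ W.transAlgHom Q (W.galFunctionField σ h / h) with hf₀
  have hf₀0 : ∀ σ, f₀ σ ≠ 0 := fun σ ↦ by
    simp only [hf₀]
    exact (map_ne_zero_iff _ (W.transAlgHom Q).toRingHom.injective).mpr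
      (div_ne_zero (hgh0 σ) hh0)
  have hf₀ord : ∀ σ (P : WeierstrassCurve.geomPoints W),
      ord (W.baseChange (AlgebraicClosure K)).toAffine P (f₀ σ) =
      (Finsupp.single (σ • T + c.1 σ) n - Finsupp.single T n) P := by
    intro σ P
    simp only [hf₀]
    rw [ord_transAlgHom, hordq, htwist, show T = T₀ - Q by rw [hT₀, add_sub_cancel_right]]
    simp only [Finsupp.sub_apply, Finsupp.single_apply, sub_eq_iff_eq_add]
  have hf₀c : IsLocallyConstant f₀ :=
    (isLocallyConstant_galFunctionField W h).comp fun u ↦ W.transAlgHom Q (u / h)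
  -- `f⁰_σ ρ_σ(f⁰_τ) = f⁰_{στ}`
  have hsplit : ∀ σ τ, f₀ σ * W.transAlgHom (-(c.1 σ)) (W.galFunctionField σ (f₀ τ)) = f₀ (σ * τ) := by
    intro σ τ
    simp only [hf₀]
    rw [galFunctionField_transAlgHom, transAlgHom_transAlgHom, hcQ,
      show -(σ • Q - Q) + σ • Q = Q by abel, ← map_mul]
    congr 1
    rw [map_div₀, ← galFunctionField_mul, div_mul_div_comm, mul_comm (W.galFunctionField σ h),
      mul_div_mul_right _ _ (hgh0 σ)]
  -- `f_σ = b(σ) f⁰_σ`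
  have hprop : ∀ σ, ∃ a : AlgebraicClosure K, a ≠ 0 ∧
      f σ = algebraMap (AlgebraicClosure K) W.geomFunctionField a * f₀ σ := fun σ ↦
    exists_eq_smul_of_ord_eq (hf₀0 σ) (hf0 σ) fun P ↦ by rw [hf₀ord, hford]
  choose b hb0 hb using hprop
  -- `b` is locally constant: `algebraMap (b σ) = f σ / f⁰ σ`
  have hbeq : ∀ σ, algebraMap (AlgebraicClosure K) W.geomFunctionField (b σ) = f σ / f₀ σ := fun σ ↦ by
    rw [hb σ, mul_div_cancel_right₀ _ (hf₀0 σ)]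
    -- careful: `hb σ : f σ = _` was used to rewrite `f σ`
  have hbc : IsLocallyConstant b := by
    let g : W.geomFunctionField → AlgebraicClosure K := fun u ↦
      if h : ∃ x, algebraMap (AlgebraicClosure K) W.geomFunctionField x = u then h.choose else 0
    have hg : ∀ x, g (algebraMap (AlgebraicClosure K) W.geomFunctionField x) = x := fun x ↦ by
      have hex : ∃ y, algebraMap (AlgebraicClosure K) W.geomFunctionField y =
          algebraMap (AlgebraicClosure K) W.geomFunctionField x := ⟨x, rfl⟩
      simp only [g, dif_pos hex]
      exact (algebraMap (AlgebraicClosure K) W.geomFunctionField).injective hex.choose_spec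
    have heq : b = g ∘ fun σ ↦ f σ / f₀ σ := by
      funext σ
      rw [Function.comp_apply, ← hbeq, hg]
    rw [heq]
    exact (hfc.comp₂ hf₀c fun x y ↦ x / y).comp g
  refine ⟨b, hbc, hb0, fun σ τ ↦ ?_⟩
  have hρf : W.transAlgHom (-(c.1 σ)) (W.galFunctionField σ (f τ)) =
      algebraMap (AlgebraicClosure K) W.geomFunctionField (σ • b τ) *
        W.transAlgHom (-(c.1 σ)) (W.galFunctionField σ (f₀ τ)) := by
    rw [hb τ, map_mul, map_mul, twistGal_algebraMap]
  rw [hρf, hb σ, hb (σ * τ), ← hsplit σ τ]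
  have h1 := hf₀0 σ
  have h2 : W.transAlgHom (-(c.1 σ)) (W.galFunctionField σ (f₀ τ)) ≠ 0 :=
    ((twistGal_injective W c σ).ne_iff' (by simp only [map_zero])).mpr (hf₀0 τ)
  have h3 : algebraMap (AlgebraicClosure K) W.geomFunctionField (b (σ * τ)) ≠ 0 :=
    (_root_.map_ne_zero _).mpr (hb0 (σ * τ))
  rw [map_div₀, map_mul]
  field_simp

end Principal

end Literature.NumberTheory.EllipticCurves
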